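import Summits.PneNP.PneNP.Theorems.SymmetryBudgetHamCompilesStubKotzigAux3
import Literature.Combinatorics.SimpleGraph.HamiltonianSubdivision

/-!
# Stub `stub_kotzig` of line `kotzig-cutspan` (crux `SymmetryBudget.HamCompiles`,
stmt-PneNP-10637) — auxiliary file 4

Route `PneNP/SymmetryBudget`, crux `Summit.PneNP.PneNP.Theses.SymmetryBudget.HamCompiles`, line
`kotzig-cutspan`, stub `stub_kotzig` (`G.IsHamiltonian ↔ KotzigPred G F`).

List combinatorics for the forward direction (cutting a Hamiltonian cycle at its A–F junctions),
without introducing definitions: a nonempty list `m` is the vertex sequence `(m.headD d, m.tail)`;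
the alternating maximal runs `[P₁, Q₁, P₂, Q₂, …]` of the cycle are grouped into a list `ps` of
pairs `(P_k, Q_k)` with `ps.flatMap (fun ab => [ab.1, ab.2]) = [P₁, Q₁, …]` (`exists_pairs`);
the labelled A-family is read off `ps.zip (ps.rotate 1)` (the A-run `Q_k` labelled by the keys of
`last P_k` and of `first P_{k+1}`, cyclically), whose entries are consecutive pairs or the
wrap-around pair (`mem_zip_rotate_one`, `getElem_mem_zip_rotate_one`); rotation invariance of
cyclic listings is the tree's `Literature.Combinatorics.SimpleGraph.IsHamCycleListing.rotate`.  Finally,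
`IsHamCycleListing.rotate`: cyclic listings are invariant under rotation.
-/

-- `Summit.PneNP.PneNP.…` duplicates `PneNP` BY DESIGN (single-problem summit, D-0017).
set_option linter.dupNamespace false

namespace Summit.PneNP.PneNP.Theorems.HamCompilesKC

open Finset Literature.Combinatorics.SimpleGraph

/-! ### Runs and pairs of runs -/

section Runs

variable {V : Type*}

/-- The vertices of the vertex sequence `(m.headD d, m.tail)` of a nonempty list `m` are `m`. -/
theorem verts_headD_tail (d : V) {m : List V} (hm : m ≠ []) :
    VSeq.verts (m.headD d, m.tail) = m := by
  cases m with
  | nil => exact absurd rfl hm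
  | cons a l => rfl

/-- The first vertex of `(m.headD d, m.tail)`. -/
theorem first_headD_tail (d : V) (m : List V) : VSeq.first (m.headD d, m.tail) = m.headD d :=
  rfl

/-- The last vertex of `(m.headD d, m.tail)`. -/
theorem last_headD_tail (d : V) (m : List V) :
    VSeq.last (m.headD d, m.tail) = m.getLastD d := by
  cases m <;> rfl

/-- Constancy of membership in `F` along a chain of equivalences. -/
theorem const_of_isChain (F : Finset V) : ∀ {m : List V},
    List.IsChain (fun x y => (x ∈ F ↔ y ∈ F)) m → ∀ x ∈ m, ∀ y ∈ m, (x ∈ F ↔ y ∈ F)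
  | [], _ => by simp
  | [a], _ => by simp
  | a :: b :: l, h => by
    obtain ⟨hab, h'⟩ := List.isChain_cons_cons.1 h
    have IH := const_of_isChain F h'
    have key : ∀ z ∈ a :: b :: l, (z ∈ F ↔ b ∈ F) := by
      intro z hz
      rcases List.mem_cons.1 hz with rfl | hz
      · exact hab
      · exact IH z hz b List.mem_cons_self
    intro x hx y hy
    exact (key x hx).trans (key y hy).symm

/-- The first components of a list of pairs form a sublist of its interleaving. -/
theorem map_fst_sublist_flatMap : ∀ ps : List (List V × List V),
    (ps.map Prod.fst).Sublist (ps.flatMap fun ab => [ab.1, ab.2])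
  | [] => List.Sublist.slnil
  | ab :: ps => by
    rw [List.map_cons, List.flatMap_cons]
    exact ((map_fst_sublist_flatMap ps).cons _).cons_cons _

/-- The second components of a list of pairs form a sublist of its interleaving. -/
theorem map_snd_sublist_flatMap : ∀ ps : List (List V × List V),
    (ps.map Prod.snd).Sublist (ps.flatMap fun ab => [ab.1, ab.2])
  | [] => List.Sublist.slnil
  | ab :: ps => by
    rw [List.map_cons, List.flatMap_cons]
    exact ((map_snd_sublist_flatMap ps).cons_cons _).cons _

/-- `head?` of an interleaving. -/
theorem head?_flatMap_pair : ∀ ps : List (List V × List V),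
    (ps.flatMap fun ab => [ab.1, ab.2]).head? = ps.head?.map Prod.fst
  | [] => rfl
  | _ :: _ => rfl

/-- `getLast?` of an interleaving. -/
theorem getLast?_flatMap_pair : ∀ ps : List (List V × List V),
    (ps.flatMap fun ab => [ab.1, ab.2]).getLast? = ps.getLast?.map Prod.snd
  | [] => rfl
  | [ab] => rfl
  | ab :: ab' :: ps => by
    have IH := getLast?_flatMap_pair (ab' :: ps)
    simp only [List.flatMap_cons, List.cons_append, List.nil_append,
      List.getLast?_cons_cons] at IH ⊢
    exact IH

/-- A chain condition on an interleaving splits into conditions inside and between pairs. -/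
theorem isChain_flatMap_pair {T : List V → List V → Prop} : ∀ (ps : List (List V × List V)),
    List.IsChain T (ps.flatMap fun ab => [ab.1, ab.2]) →
      (∀ ab ∈ ps, T ab.1 ab.2) ∧ List.IsChain (fun ab ab' => T ab.2 ab'.1) ps
  | [], _ => by simp
  | [ab], h => by simpa using h
  | ab :: ab' :: ps, h => by
    simp only [List.flatMap_cons, List.cons_append, List.nil_append] at h
    rw [List.isChain_cons_cons, List.isChain_cons_cons] at h
    have IH := isChain_flatMap_pair (ab' :: ps)
      (by simpa only [List.flatMap_cons, List.cons_append, List.nil_append] using h.2.2)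
    refine ⟨fun x hx => ?_, List.IsChain.cons_cons h.2.1 IH.2⟩
    rcases List.mem_cons.1 hx with rfl | hx
    · exact h.1
    · exact IH.1 x hx

/-- **Pairing the alternating runs.** A family of nonempty lists, each of constant membership in
`F`, with membership flipping between consecutive lists, starting inside `F` and ending outside
`F`, is the interleaving of a list of pairs (F-run, A-run). -/
theorem exists_pairs (F : Finset V) : ∀ (R : List (List V)), [] ∉ R →
    (∀ m ∈ R, ∀ x ∈ m, ∀ y ∈ m, (x ∈ F ↔ y ∈ F)) →
    List.IsChain (fun a b => ∃ ha hb, ¬ (a.getLast ha ∈ F ↔ b.head hb ∈ F)) R →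
    (∀ m ∈ R.head?, ∀ x ∈ m.head?, x ∈ F) → (∀ m ∈ R.getLast?, ∀ x ∈ m.getLast?, x ∉ F) →
    ∃ ps : List (List V × List V), (ps.flatMap fun ab => [ab.1, ab.2]) = R ∧
      ∀ ab ∈ ps, (∀ v ∈ ab.1, v ∈ F) ∧ (∀ v ∈ ab.2, v ∉ F)
  | [], _, _, _, _, _ => ⟨[], rfl, by simp⟩
  | [a], hnil, hconst, _, hfirst, hlast => by
    exfalso
    have ha : a ≠ [] := fun h => hnil (by simp [h])
    have h1 : a.head ha ∈ F := hfirst a rfl _ (List.head?_eq_some_head ha)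
    have h2 : a.getLast ha ∉ F := hlast a rfl _ (List.getLast?_eq_some_getLast ha)
    exact h2 ((hconst a (by simp) _ (List.getLast_mem ha) _ (List.head_mem ha)).2 h1)
  | a :: b :: R', hnil, hconst, hch, hfirst, hlast => by
    have ha : a ≠ [] := fun h => hnil (by simp [h])
    have h1 : a.head ha ∈ F := hfirst a rfl _ (List.head?_eq_some_head ha)
    have haF : ∀ v ∈ a, v ∈ F := fun v hv =>
      (hconst a (by simp) v hv _ (List.head_mem ha)).2 h1
    obtain ⟨⟨ha', hb', hflip⟩, hch'⟩ := List.isChain_cons_cons.1 hch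
    have h2 : b.head hb' ∉ F := fun h => hflip ⟨fun _ => h, fun _ => haF _ (List.getLast_mem ha')⟩
    have hbA : ∀ v ∈ b, v ∉ F := fun v hv h =>
      h2 ((hconst b (by simp) _ (List.head_mem hb') v hv).2 h)
    rcases R' with _ | ⟨c, R''⟩
    · refine ⟨[(a, b)], rfl, ?_⟩
      simp only [List.mem_singleton, forall_eq]
      exact ⟨haF, hbA⟩
    · obtain ⟨⟨hb'', hc', hflip'⟩, -⟩ := List.isChain_cons_cons.1 hch'
      have h3 : c.head hc' ∈ F := by
        by_contra h
        exact hflip' ⟨fun h' => absurd h' (hbA _ (List.getLast_mem hb'')), fun h' => absurd h' h⟩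
      obtain ⟨ps', hps', hmem'⟩ := exists_pairs F (c :: R'') (fun h => hnil (by simp_all))
        (fun m hm => hconst m (by simp_all)) hch'.tail
        (by
          rintro m hm x hx
          rw [List.head?_cons, Option.mem_def, Option.some.injEq] at hm
          subst hm
          rw [List.head?_eq_some_head hc', Option.mem_def, Option.some.injEq] at hx
          exact hx ▸ h3)
        (fun m hm => hlast m (by rwa [List.getLast?_cons_cons, List.getLast?_cons_cons]))
      refine ⟨(a, b) :: ps', by rw [List.flatMap_cons, hps']; rfl, ?_⟩
      rintro ab hab
      rcases List.mem_cons.1 hab with rfl | hab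
      · exact ⟨haF, hbA⟩
      · exact hmem' ab hab

/-- Entries of `l.zip (l.rotate 1)` are consecutive pairs of `l`, or the wrap-around pair. -/
theorem mem_zip_rotate_one {α : Type*} {l : List α} {x y : α} (h : (x, y) ∈ l.zip (l.rotate 1)) :
    ∃ (i : ℕ) (hi : i < l.length), l[i] = x ∧
      ((∃ hi' : i + 1 < l.length, l[i + 1] = y) ∨ (i + 1 = l.length ∧ l[0]'(by omega) = y)) := by
  obtain ⟨i, hi, e⟩ := List.getElem_of_mem h
  rw [List.length_zip, List.length_rotate, min_self] at hi
  rw [List.getElem_zip, Prod.mk.injEq, List.getElem_rotate] at e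
  refine ⟨i, hi, e.1, ?_⟩
  by_cases hi' : i + 1 < l.length
  · left
    refine ⟨hi', ?_⟩
    rw [← e.2]
    exact (getElem_congr_idx (Nat.mod_eq_of_lt hi')).symm
  · right
    refine ⟨by omega, ?_⟩
    rw [← e.2]
    exact (getElem_congr_idx (by rw [show i + 1 = l.length by omega, Nat.mod_self])).symm

/-- Consecutive pairs of `l` are entries of `l.zip (l.rotate 1)`. -/
theorem getElem_mem_zip_rotate_one {α : Type*} {l : List α} {i : ℕ} (hi : i + 1 < l.length) :
    (l[i], l[i + 1]) ∈ l.zip (l.rotate 1) := by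
  have hi2 : i < (l.zip (l.rotate 1)).length := by
    rw [List.length_zip, List.length_rotate, min_self]
    omega
  have e : (l.zip (l.rotate 1))[i] = (l[i], l[i + 1]) := by
    rw [List.getElem_zip, Prod.mk.injEq, List.getElem_rotate]
    exact ⟨rfl, getElem_congr_idx (Nat.mod_eq_of_lt hi)⟩
  exact e ▸ List.getElem_mem hi2

end Runs


/-- Registered sub-goal of `stub_kotzig` served by this file (`--supports stmt-PneNP-10637`):
pairing the alternating runs, `exists_pairs`. -/
theorem stub_kotzig_pairs {V : Type*} (F : Finset V) (R : List (List V)) (hnil : [] ∉ R)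
    (hconst : ∀ m ∈ R, ∀ x ∈ m, ∀ y ∈ m, (x ∈ F ↔ y ∈ F))
    (hch : List.IsChain (fun a b => ∃ ha hb, ¬ (a.getLast ha ∈ F ↔ b.head hb ∈ F)) R)
    (hfirst : ∀ m ∈ R.head?, ∀ x ∈ m.head?, x ∈ F)
    (hlast : ∀ m ∈ R.getLast?, ∀ x ∈ m.getLast?, x ∉ F) :
    ∃ ps : List (List V × List V), (ps.flatMap fun ab => [ab.1, ab.2]) = R ∧
      ∀ ab ∈ ps, (∀ v ∈ ab.1, v ∈ F) ∧ (∀ v ∈ ab.2, v ∉ F) :=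
  exists_pairs F R hnil hconst hch hfirst hlast

end Summit.PneNP.PneNP.Theorems.HamCompilesKC
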